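/-
Copyright: the m5 harness (cell B2b-5 `b2b-lgcu-borel`, generation 21).  Sorry-free; axioms: propext,
Classical.choice, Quot.sound.  VALUE = THEOREM (a 2-member, budget-free exclusion on the level-one
slice), NOT summit progress: the crux `SubgroupIdentityDesigns` is untouched.
-/
import Mathlib
import Summits.MatrixMultiplication.MatrixMultiplication.Theorems.SubgroupIdentityDesigns.Negative.ProductObstruction

/-!
# Pair exclusion: two members with line-confined admissible sets

An instance of the separation exclusions of `ProductObstruction` with genuine 2-member content.

Say a subgroup `H ≤ GL_m(𝔽_p)` is DET-COVERED OFF THE LINE `ℓ = 𝔽_p e` (for a character `χ` of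
`𝔽_pˣ`) if every vector outside `ℓ` is fixed by an element `g ∈ H` with `χ(det g) ≠ 1`.  Then the
admissible set of `σ = χ ∘ det` on `H` is confined to `ℓ ∖ {0}` (`adm_subset_line`).  Example
(paper level, `run/shared/lean/b2b/levelgraded-cu/ORACLE-g21.md` §G21-12): the CENTRE-`ℓ`
DILATATION GROUP `K_A(ℓ) = {g : (g − 1)𝔽_p^m ⊆ ℓ, g|_ℓ ∈ A}` (`A ≤ 𝔽_pˣ` non-trivial, order
`|A| p^{m−1}`), and every overgroup: for `w ∉ ℓ` the element `1 + e ⊗ f` with `f(w) = 0`,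
`f(e) = a − 1` (`a ∈ A`, `χ(a) ≠ 1`) fixes `w` and has determinant `a`.  Such a group satisfies the
single-member admissibility principle (`adm = ℓ ∖ 0 ≠ ∅`, `ν_σ = (p − 1)/|A|` orbits) and, for
`|A| < p − 1`, every single-member law of this directory.

* `no_design_of_two_lines₁₂` / `no_design_of_two_lines₂₃` — **if `H₁` is det-covered off a line
  `ℓ₁` and `H₂` off a line `ℓ₂` with `ℓ₁ ∩ ℓ₂ = 0` (resp. `H₂`, `H₃`), a subgroup-TPP triple
  `(H₁, H₂, H₃)` carries no level-one identity design** — every `p`, `m`, exponent; the third member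
  is arbitrary.  (Under the TPP the lines are automatically distinct when both members contain the
  full translation groups with centres `ℓ₁`, `ℓ₂`: `H₁ ∩ H₂ = 1`.)
* `no_design_of_two_lines₁₃` — members `1, 3`: the same when, in addition, no element of `H₂` maps
  `ℓ₃` into `ℓ₁`.
* `detCoveredOff_of_dil`, `no_design_of_dil₁₂`, `no_design_of_dil₂₃` — the COORDINATE INSTANCE:
  the dilatations `d(a, j, s) = 1 + (a − 1)E_{i₀i₀} + sE_{i₀j}` (`j ≠ i₀`; `det = a`) cover
  everything off `𝔽_p e_{i₀}`; **no two adjacent members contain such families (one `a` with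
  `χ(a) ≠ 1` each) at different coordinates `i₀ ≠ i₁`**.

Mechanism: `adm(H₁, χ₁∘det) ⊆ ℓ₁ ∖ 0` and `adm(H₂, χ₂∘det) ⊆ ℓ₂ ∖ 0` are disjoint, so the
product-character functional of `(χ₁∘det, χ₂∘det, 1)` vanishes on `F_1` but equals `1` on a test.
This exclusion is invisible to order counting and to every single-member law.
-/

noncomputable section

open scoped BigOperators Classical Matrix

namespace Summit.MatrixMultiplication.MatrixMultiplication.Theorems.SubgroupIdentityDesigns.Negative
namespace PairExclusion

open Literature.Barriers.MatrixMultiplication (SubgroupTPP)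
open Summit.MatrixMultiplication.MatrixMultiplication.Theorems.LieRankDesigns.Negative (GLm Mat)
open Summit.MatrixMultiplication.MatrixMultiplication.Theorems.LevelOneGL2Designs.Negative
open LevelOneEquivariantDim (adm mem_adm smul_mem_adm)
open ProductObstruction (no_design_of_disjoint₁₂ no_design_of_disjoint₂₃ no_design_of_separated₁₃)

variable {p m : ℕ} [hp : Fact p.Prime]

/-- The determinant character `χ ∘ det` restricted to a subgroup `H`. -/
def detChar (H : Subgroup (GLm p m)) (χ : (ZMod p)ˣ →* ℂˣ) : H →* ℂˣ :=
  χ.comp (Matrix.GeneralLinearGroup.det.comp H.subtype)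

/-- Unfolding `detChar`. -/
theorem detChar_apply (H : Subgroup (GLm p m)) (χ : (ZMod p)ˣ →* ℂˣ) (h : H) :
    detChar H χ h = χ (Matrix.GeneralLinearGroup.det (h : GLm p m)) := rfl

/-- `H` is det-covered off the line `𝔽_p e` for `χ`: every vector outside the line is fixed by an
element of `H` whose determinant is not killed by `χ`. -/
def DetCoveredOff (H : Subgroup (GLm p m)) (χ : (ZMod p)ˣ →* ℂˣ) (e : Fin m → ZMod p) : Prop :=
  ∀ w : Fin m → ZMod p, (∀ t : ZMod p, w ≠ t • e) →
    ∃ g ∈ H, g • w = w ∧ χ (Matrix.GeneralLinearGroup.det g) ≠ 1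

/-- **Confinement**: if `H` is det-covered off `𝔽_p e`, every `χ∘det`-admissible vector lies on
the line `𝔽_p e`. -/
theorem adm_subset_line {H : Subgroup (GLm p m)} {χ : (ZMod p)ˣ →* ℂˣ} {e : Fin m → ZMod p}
    (hH : DetCoveredOff H χ e) {w : Fin m → ZMod p} (hw : w ∈ adm H (detChar H χ)) :
    ∃ t : ZMod p, w = t • e := by
  by_contra hcon
  push Not at hcon
  obtain ⟨g, hg, hfix, hχ⟩ := hH w hcon
  exact hχ (by rw [← detChar_apply H χ ⟨g, hg⟩]; exact hw ⟨g, hg⟩ hfix)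

/-- If `H` is det-covered off `𝔽_p e` and some vector lies off that line, `0` is not admissible. -/
theorem zero_not_mem_adm {H : Subgroup (GLm p m)} {χ : (ZMod p)ˣ →* ℂˣ} {e : Fin m → ZMod p}
    (hH : DetCoveredOff H χ e) {w₀ : Fin m → ZMod p} (hw₀ : ∀ t : ZMod p, w₀ ≠ t • e) :
    (0 : Fin m → ZMod p) ∉ adm H (detChar H χ) := by
  obtain ⟨g, hg, -, hχ⟩ := hH w₀ hw₀
  intro h0
  refine hχ ?_
  rw [← detChar_apply H χ ⟨g, hg⟩]
  exact h0 ⟨g, hg⟩ (smul_zero _)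

/-- **Disjointness**: admissible sets confined to two lines meeting only in `0` are disjoint. -/
theorem disjoint_adm_of_two_lines {H H' : Subgroup (GLm p m)} {χ χ' : (ZMod p)ˣ →* ℂˣ}
    {e e' : Fin m → ZMod p} (hH : DetCoveredOff H χ e) (hH' : DetCoveredOff H' χ' e')
    (hmeet : ∀ s t : ZMod p, s • e = t • e' → s • e = 0) (he' : ∀ t : ZMod p, e' ≠ t • e) :
    Disjoint (adm H (detChar H χ)) (adm H' (detChar H' χ')) := by
  rw [Set.disjoint_left]
  intro w hw hw'
  obtain ⟨s, hs⟩ := adm_subset_line hH hw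
  obtain ⟨t, ht⟩ := adm_subset_line hH' hw'
  have hw0 : w = 0 := by rw [hs]; exact hmeet s t (hs.symm.trans ht)
  rw [hw0] at hw
  exact zero_not_mem_adm hH he' hw

variable {H₁ H₂ H₃ : Subgroup (GLm p m)}

/-- **PAIR EXCLUSION, members 1–2.**  If `H₁` is det-covered off a line `ℓ₁ = 𝔽_p e₁` and `H₂`
off a line `ℓ₂ = 𝔽_p e₂` with `ℓ₁ ∩ ℓ₂ = 0`, then the subgroup-TPP triple `(H₁, H₂, H₃)` carries
no level-one identity design (notation of the crux at `k = 1`; every `p`, `m`, exponent). -/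
theorem no_design_of_two_lines₁₂ (htpp : SubgroupTPP H₁ H₂ H₃) {χ₁ χ₂ : (ZMod p)ˣ →* ℂˣ}
    {e₁ e₂ : Fin m → ZMod p} (h₁ : DetCoveredOff H₁ χ₁ e₁) (h₂ : DetCoveredOff H₂ χ₂ e₂)
    (hmeet : ∀ s t : ZMod p, s • e₁ = t • e₂ → s • e₁ = 0) (he₂ : ∀ t : ZMod p, e₂ ≠ t • e₁) :
    ¬ ∃ c : Mat p m → ℂ, (∀ M, 1 < M.rank → c M = 0) ∧
      (∑ M, c M * ZMod.stdAddChar (Matrix.trace (M * ((1 : GLm p m) : Mat p m)))) = 1 ∧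
      ∀ a ∈ H₁, ∀ b ∈ H₂, ∀ g ∈ H₃, a * b * g ≠ 1 →
        (∑ M, c M * ZMod.stdAddChar (Matrix.trace (M * ((a * b * g : GLm p m) : Mat p m)))) = 0 :=
  no_design_of_disjoint₁₂ htpp (detChar H₁ χ₁) (detChar H₂ χ₂)
    (disjoint_adm_of_two_lines h₁ h₂ hmeet he₂)

/-- **PAIR EXCLUSION, members 2–3.** -/
theorem no_design_of_two_lines₂₃ (htpp : SubgroupTPP H₁ H₂ H₃) {χ₂ χ₃ : (ZMod p)ˣ →* ℂˣ}
    {e₂ e₃ : Fin m → ZMod p} (h₂ : DetCoveredOff H₂ χ₂ e₂) (h₃ : DetCoveredOff H₃ χ₃ e₃)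
    (hmeet : ∀ s t : ZMod p, s • e₂ = t • e₃ → s • e₂ = 0) (he₃ : ∀ t : ZMod p, e₃ ≠ t • e₂) :
    ¬ ∃ c : Mat p m → ℂ, (∀ M, 1 < M.rank → c M = 0) ∧
      (∑ M, c M * ZMod.stdAddChar (Matrix.trace (M * ((1 : GLm p m) : Mat p m)))) = 1 ∧
      ∀ a ∈ H₁, ∀ b ∈ H₂, ∀ g ∈ H₃, a * b * g ≠ 1 →
        (∑ M, c M * ZMod.stdAddChar (Matrix.trace (M * ((a * b * g : GLm p m) : Mat p m)))) = 0 :=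
  no_design_of_disjoint₂₃ htpp (detChar H₂ χ₂) (detChar H₃ χ₃)
    (disjoint_adm_of_two_lines h₂ h₃ hmeet he₃)

/-- **PAIR EXCLUSION, members 1–3** (with the middle member not mapping `ℓ₃` into `ℓ₁`). -/
theorem no_design_of_two_lines₁₃ (htpp : SubgroupTPP H₁ H₂ H₃) {χ₁ χ₃ : (ZMod p)ˣ →* ℂˣ}
    {e₁ e₃ : Fin m → ZMod p} (h₁ : DetCoveredOff H₁ χ₁ e₁) (h₃ : DetCoveredOff H₃ χ₃ e₃)
    (hmove : ∀ b ∈ H₂, ∀ s t : ZMod p, b • (t • e₃) = s • e₁ → s • e₁ = 0)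
    (he₃ : ∀ t : ZMod p, e₃ ≠ t • e₁) :
    ¬ ∃ c : Mat p m → ℂ, (∀ M, 1 < M.rank → c M = 0) ∧
      (∑ M, c M * ZMod.stdAddChar (Matrix.trace (M * ((1 : GLm p m) : Mat p m)))) = 1 ∧
      ∀ a ∈ H₁, ∀ b ∈ H₂, ∀ g ∈ H₃, a * b * g ≠ 1 →
        (∑ M, c M * ZMod.stdAddChar (Matrix.trace (M * ((a * b * g : GLm p m) : Mat p m)))) = 0 := by
  refine no_design_of_separated₁₃ htpp (detChar H₁ χ₁) (detChar H₃ χ₃) fun w hw3 b hw1 => ?_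
  obtain ⟨t, ht⟩ := adm_subset_line h₃ hw3
  obtain ⟨s, hs⟩ := adm_subset_line h₁ hw1
  have h0 : s • e₁ = 0 := hmove b b.2 s t (by rw [← ht, ← hs]; rfl)
  rw [h0] at hs
  exact zero_not_mem_adm h₁ he₃ (hs ▸ hw1)

section Dilatations

/-! ### Instance: coordinate dilatation families

`d(a, j, s) = 1 + (a − 1)E_{i₀i₀} + sE_{i₀j}` (`j ≠ i₀`): `(d v)_{i₀} = a v_{i₀} + s v_j`, other
coordinates unchanged, `det d = a`.  It fixes `v` iff `(a − 1)v_{i₀} + s v_j = 0`.  The elements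
`d(a, j, s)` (`j ≠ i₀`, `s ∈ 𝔽_p`) lie in the centre-`ℓ` dilatation group `K_A(𝔽_p e_{i₀})` for
`a ∈ A`; a subgroup containing them for one `a` with `χ(a) ≠ 1` is det-covered off `𝔽_p e_{i₀}`. -/

variable {i₀ : Fin m}

/-- Row `i₀` of `d(a, j, s)`: `a` at `i₀`, `s` at `j`, `0` elsewhere. -/
def dilRow (i₀ j : Fin m) (a s : ZMod p) : Fin m → ZMod p :=
  fun l => if i₀ = l then a else if j = l then s else 0

/-- The dilatation matrix `d(a, j, s)` (row `i₀` of `1` replaced by `dilRow`). -/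
def dilMat (i₀ j : Fin m) (a s : ZMod p) : Mat p m := Matrix.updateRow 1 i₀ (dilRow i₀ j a s)

/-- `dilRow = a · (row i₀ of 1) + s · (row j of 1)`. -/
theorem dilRow_eq {j : Fin m} (h : i₀ ≠ j) (a s : ZMod p) :
    dilRow i₀ j a s = a • (1 : Mat p m) i₀ + s • (1 : Mat p m) j := by
  funext l
  simp only [dilRow, Pi.add_apply, Pi.smul_apply, Matrix.one_apply, smul_eq_mul, mul_ite,
    mul_one, mul_zero]
  by_cases hl0 : i₀ = l
  · have hl1 : ¬j = l := fun e => h (hl0.trans e.symm)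
    rw [if_pos hl0, if_pos hl0, if_neg hl1, add_zero]
  · rw [if_neg hl0, if_neg hl0, zero_add]

/-- `det d(a, j, s) = a`. -/
theorem det_dilMat {j : Fin m} (h : i₀ ≠ j) (a s : ZMod p) : (dilMat i₀ j a s).det = a := by
  rw [dilMat, dilRow_eq h, Matrix.det_updateRow_add, Matrix.det_updateRow_smul,
    Matrix.det_updateRow_smul, Matrix.updateRow_eq_self, Matrix.det_one,
    Matrix.det_updateRow_eq_zero (Ne.symm h)]
  ring

/-- The action of `d(a, j, s)`: coordinate `i₀` becomes `a v_{i₀} + s v_j`, others unchanged. -/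
theorem dilMat_mulVec {j : Fin m} (h : i₀ ≠ j) (a s : ZMod p) (v : Fin m → ZMod p) (l : Fin m) :
    (dilMat i₀ j a s *ᵥ v) l = if l = i₀ then a * v i₀ + s * v j else v l := by
  have e1 : ∀ i, ((1 : Mat p m) *ᵥ v) i = v i := fun i => by rw [Matrix.one_mulVec]
  simp only [Matrix.mulVec, dotProduct] at e1 ⊢
  simp only [dilMat, Matrix.updateRow_apply]
  by_cases hl : l = i₀
  · simp only [if_pos hl]
    rw [dilRow_eq h]
    simp only [Pi.add_apply, Pi.smul_apply, smul_eq_mul, add_mul, Finset.sum_add_distrib,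
      mul_assoc, ← Finset.mul_sum]
    rw [e1 i₀, e1 j]
  · simp only [if_neg hl]
    exact e1 l

/-- `d(a, j, s)` as an element of `GL_m(𝔽_p)` (`a` a unit). -/
def dil {j : Fin m} (h : i₀ ≠ j) (a : (ZMod p)ˣ) (s : ZMod p) : GLm p m :=
  Matrix.GeneralLinearGroup.mkOfDetNeZero (dilMat i₀ j (a : ZMod p) s)
    (by rw [det_dilMat h]; exact a.ne_zero)

/-- Underlying matrix of `dil`. -/
theorem coe_dil {j : Fin m} (h : i₀ ≠ j) (a : (ZMod p)ˣ) (s : ZMod p) :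
    ((dil h a s : GLm p m) : Mat p m) = dilMat i₀ j (a : ZMod p) s := rfl

/-- `det d(a, j, s) = a` in `𝔽_pˣ`. -/
theorem det_dil {j : Fin m} (h : i₀ ≠ j) (a : (ZMod p)ˣ) (s : ZMod p) :
    Matrix.GeneralLinearGroup.det (dil h a s) = a :=
  Units.ext (by rw [Matrix.GeneralLinearGroup.val_det_apply, coe_dil, det_dilMat h])

/-- `d(a, j, s)` fixes `v` when `(a − 1) v_{i₀} + s v_j = 0`. -/
theorem dil_smul_eq_self {j : Fin m} (h : i₀ ≠ j) (a : (ZMod p)ˣ) {s : ZMod p}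
    {v : Fin m → ZMod p} (hv : ((a : ZMod p) - 1) * v i₀ + s * v j = 0) : dil h a s • v = v := by
  show ((dil h a s : GLm p m) : Mat p m) *ᵥ v = v
  funext l
  rw [coe_dil, dilMat_mulVec h]
  by_cases hl : l = i₀
  · rw [if_pos hl, hl]
    linear_combination hv
  · rw [if_neg hl]

/-- **A subgroup containing a coordinate dilatation family is det-covered off the coordinate
line**: if `χ(a) ≠ 1` and `d(a, j, s) ∈ H` for all `j ≠ i₀`, `s ∈ 𝔽_p`, then every vector off
`𝔽_p e_{i₀}` is fixed by an element of `H` of determinant `a`. -/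
theorem detCoveredOff_of_dil {H : Subgroup (GLm p m)} {χ : (ZMod p)ˣ →* ℂˣ} {a : (ZMod p)ˣ}
    (hχ : χ a ≠ 1) (hH : ∀ (j : Fin m) (h : i₀ ≠ j) (s : ZMod p), dil h a s ∈ H) :
    DetCoveredOff H χ (Pi.single i₀ 1) := by
  intro w hw
  -- `w` off the line has a non-zero coordinate `j ≠ i₀`
  obtain ⟨j, hj, hwj⟩ : ∃ j, i₀ ≠ j ∧ w j ≠ 0 := by
    by_contra hcon
    push Not at hcon
    refine hw (w i₀) (funext fun l => ?_)
    by_cases hl : i₀ = l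
    · subst hl
      simp
    · rw [Pi.smul_apply, Pi.single_eq_of_ne (Ne.symm hl), smul_zero]
      exact hcon l hl
  refine ⟨dil hj a (-(((a : ZMod p) - 1) * w i₀) * (w j)⁻¹), hH j hj _, ?_, ?_⟩
  · exact dil_smul_eq_self hj a (by rw [mul_assoc, inv_mul_cancel₀ hwj]; ring)
  · rw [det_dil hj]
    exact hχ

variable {i₁ : Fin m}

/-- **No two adjacent members contain coordinate dilatation families at different coordinates**
(members 1–2): if `χ₁(a₁) ≠ 1`, `χ₂(a₂) ≠ 1`, `H₁ ∋ d_{i₀}(a₁, j, s)` for all `j ≠ i₀, s`, and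
`H₂ ∋ d_{i₁}(a₂, j, s)` for all `j ≠ i₁, s`, with `i₀ ≠ i₁`, then the subgroup-TPP triple carries no
level-one identity design — every `p`, `m ≥ 2`, exponent.  (E.g. `H₁ ⊇ K_{A₁}(𝔽_p e_{i₀})`,
`H₂ ⊇ K_{A₂}(𝔽_p e_{i₁})` with `A₁, A₂ ≠ 1`; any pair of distinct lines by a simultaneous
conjugation of the triple.) -/
theorem no_design_of_dil₁₂ (hi : i₀ ≠ i₁) (htpp : SubgroupTPP H₁ H₂ H₃)
    {χ₁ χ₂ : (ZMod p)ˣ →* ℂˣ} {a₁ a₂ : (ZMod p)ˣ} (hχ₁ : χ₁ a₁ ≠ 1) (hχ₂ : χ₂ a₂ ≠ 1)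
    (hH₁ : ∀ (j : Fin m) (h : i₀ ≠ j) (s : ZMod p), dil h a₁ s ∈ H₁)
    (hH₂ : ∀ (j : Fin m) (h : i₁ ≠ j) (s : ZMod p), dil h a₂ s ∈ H₂) :
    ¬ ∃ c : Mat p m → ℂ, (∀ M, 1 < M.rank → c M = 0) ∧
      (∑ M, c M * ZMod.stdAddChar (Matrix.trace (M * ((1 : GLm p m) : Mat p m)))) = 1 ∧
      ∀ a ∈ H₁, ∀ b ∈ H₂, ∀ g ∈ H₃, a * b * g ≠ 1 →
        (∑ M, c M * ZMod.stdAddChar (Matrix.trace (M * ((a * b * g : GLm p m) : Mat p m)))) = 0 := by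
  refine no_design_of_two_lines₁₂ htpp (detCoveredOff_of_dil hχ₁ hH₁) (detCoveredOff_of_dil hχ₂ hH₂)
    (fun s t hst => ?_) (fun t ht => ?_)
  · have h := congr_fun hst i₀
    simp only [Pi.smul_apply, Pi.single_eq_same, Pi.single_eq_of_ne hi, smul_eq_mul, mul_one,
      mul_zero] at h
    rw [h, zero_smul]
  · have h := congr_fun ht i₁
    simp only [Pi.smul_apply, Pi.single_eq_same, Pi.single_eq_of_ne (Ne.symm hi), smul_eq_mul,
      mul_zero] at h
    exact one_ne_zero h

/-- The same for members 2–3. -/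
theorem no_design_of_dil₂₃ (hi : i₀ ≠ i₁) (htpp : SubgroupTPP H₁ H₂ H₃)
    {χ₂ χ₃ : (ZMod p)ˣ →* ℂˣ} {a₂ a₃ : (ZMod p)ˣ} (hχ₂ : χ₂ a₂ ≠ 1) (hχ₃ : χ₃ a₃ ≠ 1)
    (hH₂ : ∀ (j : Fin m) (h : i₀ ≠ j) (s : ZMod p), dil h a₂ s ∈ H₂)
    (hH₃ : ∀ (j : Fin m) (h : i₁ ≠ j) (s : ZMod p), dil h a₃ s ∈ H₃) :
    ¬ ∃ c : Mat p m → ℂ, (∀ M, 1 < M.rank → c M = 0) ∧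
      (∑ M, c M * ZMod.stdAddChar (Matrix.trace (M * ((1 : GLm p m) : Mat p m)))) = 1 ∧
      ∀ a ∈ H₁, ∀ b ∈ H₂, ∀ g ∈ H₃, a * b * g ≠ 1 →
        (∑ M, c M * ZMod.stdAddChar (Matrix.trace (M * ((a * b * g : GLm p m) : Mat p m)))) = 0 := by
  refine no_design_of_two_lines₂₃ htpp (detCoveredOff_of_dil hχ₂ hH₂) (detCoveredOff_of_dil hχ₃ hH₃)
    (fun s t hst => ?_) (fun t ht => ?_)
  · have h := congr_fun hst i₀
    simp only [Pi.smul_apply, Pi.single_eq_same, Pi.single_eq_of_ne hi, smul_eq_mul, mul_one,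
      mul_zero] at h
    rw [h, zero_smul]
  · have h := congr_fun ht i₁
    simp only [Pi.smul_apply, Pi.single_eq_same, Pi.single_eq_of_ne (Ne.symm hi), smul_eq_mul,
      mul_zero] at h
    exact one_ne_zero h

end Dilatations

end PairExclusion
end Summit.MatrixMultiplication.MatrixMultiplication.Theorems.SubgroupIdentityDesigns.Negative

end
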